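import Summits.NavierStokesRegularity.NavierStokesRegularity.Theorems.SoloSalvageWu2026TangentLocal
import HarnessLib

/-!
# C177 `Wu2026` — SALVAGE, TRUE column: **`Step_385` PROVED** — passage to the tangent current,
# (3.83)–(3.85) (D-0090 NS-CLAIMS, LADDER row rung 3; salvage seat `ns-claims-salvage-p3`)

Kernel proof of the binder `Literature.Claims.NS.Wu2026.Step_385` of `claim_of_steps''` (skeleton
p558978 / p560520, typist-10 g6), EXACTLY as typed: for an `IsWuFlow` with `D > 0` and an Euler
blow-down tangent `T`, the limit current `Q V·y/|y|³` is integrable on `{|y| > 1}` and the physical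
currents `current382 (R_j) v (p − c)` converge to `−tangentCurrent T.V T.P` (p.25 l.127 – p.26 l.84).

Assembly (the print's three moves, p.26 l.60–84):
* (3.83) exact rescaling `current382 R_j = −∫_{|y|>1} Q_jV_j·y/|y|³` (`current382_eq_blowDown`,
  `SoloSalvageWu2026Scaling`);
* (3.78)/(3.84) the uniform Abel tail `sup_j ∫_{|y|>L}|Q_jV_j|/|y|² ≤ C/L` from the weak data
  `Tangent.weakP` (`exists_rescaled_tail_le`, `SoloSalvageWu2026AbelTail`), and the limit tail
  `∫_{|y|>L}|QV|/|y|² ≤ 2C/L` by the local convergence on the compact shells `{L ≤ |y| ≤ M}` and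
  monotone exhaustion `M → ∞` («Fatou's lemma and (3.78) give (3.84)»; `lintegral_tail_limit_le`);
* (3.85) «First letting j → ∞ and then L → ∞»: `∫_{|y|>1}|Q_jV_j·n − QV·n|/|y|² ≤
  ∫_{1≤|y|≤L}|…| + C/L + 2C/L`, the shell term → 0 by `tendsto_lintegral_bernV_sub`
  (`SoloSalvageWu2026TangentLocal`), then Mathlib's `tendsto_integral_of_L1` on `{|y| > 1}`.

Theorems only, standard axioms, no `sorry`.

WHAT THIS IS NOT: not a claim about NS regularity or blow-up; not a claim about any author beyond the
typed locator.
-/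

set_option linter.dupNamespace false

noncomputable section

open MeasureTheory Set Filter Topology Module Metric
open scoped ENNReal NNReal Topology RealInnerProductSpace

namespace Summit.NavierStokesRegularity.NavierStokesRegularity.Theorems.Wu2026Salvage

open Literature.Analysis.FluidPDE Literature.Analysis.FunctionSpaces Literature.Claims.NS.Wu2026

/-! ## Pointwise facts on the current integrand `Q V·y/|y|³` -/

/-- `|Q₁V₁·y/|y|³ − Q₂V₂·y/|y|³| ≤ |Q₁V₁ − Q₂V₂| |y|⁻²`. [cite: Wu2026, (3.85) proof p.26 l.68–76] -/
theorem enorm_current_sub_le (V₁ V₂ : E3 → E3) (P₁ P₂ : E3 → ℝ) (y : E3) :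
    ‖bern V₁ P₁ y * ⟪V₁ y, y⟫ / ‖y‖ ^ 3 - bern V₂ P₂ y * ⟪V₂ y, y⟫ / ‖y‖ ^ 3‖ₑ ≤
      ‖bern V₁ P₁ y • V₁ y - bern V₂ P₂ y • V₂ y‖ₑ * ENNReal.ofReal (‖y‖ ^ (-(2 : ℝ))) := by
  by_cases hy : y = 0
  · subst hy
    simp
  have hn : 0 < ‖y‖ := norm_pos_iff.2 hy
  have hreal : ‖bern V₁ P₁ y * ⟪V₁ y, y⟫ / ‖y‖ ^ 3 - bern V₂ P₂ y * ⟪V₂ y, y⟫ / ‖y‖ ^ 3‖ ≤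
      ‖bern V₁ P₁ y • V₁ y - bern V₂ P₂ y • V₂ y‖ * ‖y‖ ^ (-(2 : ℝ)) := by
    rw [Real.norm_eq_abs, ← sub_div, ← real_inner_smul_left, ← real_inner_smul_left,
      ← inner_sub_left, abs_div, abs_of_pos (pow_pos hn 3), div_le_iff₀ (pow_pos hn 3),
      Real.rpow_neg hn.le, Real.rpow_two]
    calc |⟪bern V₁ P₁ y • V₁ y - bern V₂ P₂ y • V₂ y, y⟫|
        ≤ ‖bern V₁ P₁ y • V₁ y - bern V₂ P₂ y • V₂ y‖ * ‖y‖ := abs_real_inner_le_norm _ _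
      _ = ‖bern V₁ P₁ y • V₁ y - bern V₂ P₂ y • V₂ y‖ * (‖y‖ ^ 2)⁻¹ * ‖y‖ ^ 3 := by
          field_simp
  calc ‖bern V₁ P₁ y * ⟪V₁ y, y⟫ / ‖y‖ ^ 3 - bern V₂ P₂ y * ⟪V₂ y, y⟫ / ‖y‖ ^ 3‖ₑ
      = ENNReal.ofReal ‖bern V₁ P₁ y * ⟪V₁ y, y⟫ / ‖y‖ ^ 3 - bern V₂ P₂ y * ⟪V₂ y, y⟫ / ‖y‖ ^ 3‖ :=
        (ofReal_norm _).symm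
    _ ≤ ENNReal.ofReal (‖bern V₁ P₁ y • V₁ y - bern V₂ P₂ y • V₂ y‖ * ‖y‖ ^ (-(2 : ℝ))) :=
        ENNReal.ofReal_le_ofReal hreal
    _ = ‖bern V₁ P₁ y • V₁ y - bern V₂ P₂ y • V₂ y‖ₑ * ENNReal.ofReal (‖y‖ ^ (-(2 : ℝ))) := by
        rw [ENNReal.ofReal_mul (norm_nonneg _), ofReal_norm]

/-- `|Q V·y/|y|³| ≤ |Q||V||y|⁻²` in `ℝ≥0∞`. [cite: Wu2026, (3.77)–(3.78) p.24] -/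
theorem enorm_current_le (V : E3 → E3) (P : E3 → ℝ) (y : E3) :
    ‖bern V P y * ⟪V y, y⟫ / ‖y‖ ^ 3‖ₑ ≤ ENNReal.ofReal (|bern V P y| * ‖V y‖ * ‖y‖ ^ (-(2 : ℝ))) := by
  rw [Real.enorm_eq_ofReal_abs]
  exact ENNReal.ofReal_le_ofReal (abs_current_le_abs_bern_mul V P y)

section Tangent

variable {ν : ℝ} {v : E3 → E3} {p : E3 → ℝ}

/-! ## Local convergence of the current on shells -/

/-- On the shell `{a ≤ |y| ≤ b}`, `a > 0`: `∫ |Q_jV_j·y/|y|³ − QV·y/|y|³| → 0` along the tangent.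
[cite: Wu2026, (3.85) proof p.26 l.68–76] -/
theorem tendsto_lintegral_current_sub_shell (hflow : IsWuFlow ν v p) (T : Tangent ν v p)
    {a : ℝ} (ha : 0 < a) (b : ℝ) :
    Tendsto (fun j => ∫⁻ y in {y : E3 | a ≤ ‖y‖ ∧ ‖y‖ ≤ b},
      ‖bern (blowDown (T.R j) v) (blowDownP (T.R j) (fun x => p x - T.c)) y *
            ⟪blowDown (T.R j) v y, y⟫ / ‖y‖ ^ 3 -
          bern T.V T.P y * ⟪T.V y, y⟫ / ‖y‖ ^ 3‖ₑ) atTop (𝓝 0) := by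
  -- the closed shell is compact and avoids the origin
  have hKc : IsCompact {y : E3 | a ≤ ‖y‖ ∧ ‖y‖ ≤ b} :=
    (isCompact_closedBall (0 : E3) b).of_isClosed_subset
      ((isClosed_le continuous_const continuous_norm).inter
        (isClosed_le continuous_norm continuous_const))
      fun y hy => mem_closedBall_zero_iff.2 hy.2
  have hKp : {y : E3 | a ≤ ‖y‖ ∧ ‖y‖ ≤ b} ⊆ punctured := fun y hy h0 => by
    have : ‖y‖ = 0 := by rw [h0, norm_zero]
    linarith [hy.1]
  have h := tendsto_lintegral_bernV_sub hflow T hKc hKp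
  have hmul := ENNReal.Tendsto.mul_const h (Or.inr (ENNReal.ofReal_ne_top (r := a ^ (-(2 : ℝ)))))
  rw [zero_mul] at hmul
  refine tendsto_zero_of_le hmul fun j => ?_
  calc ∫⁻ y in {y : E3 | a ≤ ‖y‖ ∧ ‖y‖ ≤ b},
        ‖bern (blowDown (T.R j) v) (blowDownP (T.R j) (fun x => p x - T.c)) y *
              ⟪blowDown (T.R j) v y, y⟫ / ‖y‖ ^ 3 -
            bern T.V T.P y * ⟪T.V y, y⟫ / ‖y‖ ^ 3‖ₑ
      ≤ ∫⁻ y in {y : E3 | a ≤ ‖y‖ ∧ ‖y‖ ≤ b},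
          ‖bern (blowDown (T.R j) v) (blowDownP (T.R j) (fun x => p x - T.c)) y •
              blowDown (T.R j) v y - bern T.V T.P y • T.V y‖ₑ * ENNReal.ofReal (a ^ (-(2 : ℝ))) := by
        refine setLIntegral_mono' hKc.measurableSet fun y hy => ?_
        refine (enorm_current_sub_le _ _ _ _ y).trans (mul_le_mul' le_rfl ?_)
        exact ENNReal.ofReal_le_ofReal (Real.rpow_le_rpow_of_nonpos ha hy.1 (by norm_num))
    _ = (∫⁻ y in {y : E3 | a ≤ ‖y‖ ∧ ‖y‖ ≤ b},
          ‖bern (blowDown (T.R j) v) (blowDownP (T.R j) (fun x => p x - T.c)) y •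
              blowDown (T.R j) v y - bern T.V T.P y • T.V y‖ₑ) * ENNReal.ofReal (a ^ (-(2 : ℝ))) :=
        lintegral_mul_const' _ _ ENNReal.ofReal_ne_top

/-! ## (3.84): the tail of the limit current -/

/-- **(3.84)** («Fatou's lemma and (3.78) give `∫_{|y|>L}|QV|/|y|² ≤ C/L`»): if the rescaled tails obey
`∫_{|y|>L}|Q_R||V_R||y|⁻² ≤ C/L` for all `R, L > 0`, then along the tangent the LIMIT current has
`∫_{|y|>L} |QV·y/|y|³| ≤ C·(L/2)⁻¹` for every `L > 0` (local `L¹` convergence on the compact shells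
`{L ≤ |y| ≤ M} ⊆ {|y| > L/2}`, then `M → ∞` by monotone exhaustion). [cite: Wu2026, (3.84) p.26 l.60–67] -/
theorem lintegral_tail_limit_le (hflow : IsWuFlow ν v p) (T : Tangent ν v p) {C : ℝ≥0∞}
    (hC : ∀ R : ℝ, 0 < R → ∀ L : ℝ, 0 < L →
      ∫⁻ y in {y : E3 | L < ‖y‖}, ENNReal.ofReal
          (|bern (blowDown R v) (blowDownP R (fun x => p x - T.c)) y| * ‖blowDown R v y‖ *
            ‖y‖ ^ (-(2 : ℝ))) ≤ C * ENNReal.ofReal L⁻¹)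
    {L : ℝ} (hL : 0 < L) :
    ∫⁻ y in {y : E3 | L < ‖y‖}, ‖bern T.V T.P y * ⟪T.V y, y⟫ / ‖y‖ ^ 3‖ₑ ≤
      C * ENNReal.ofReal (L / 2)⁻¹ := by
  have hvc : Continuous v := hflow.smooth_v.continuous
  have hqc : Continuous fun x => p x - T.c := hflow.smooth_p.continuous.sub continuous_const
  -- Step A: the bound on every compact shell `{L ≤ |y| ≤ M}`
  have hA : ∀ M : ℝ, ∫⁻ y in {y : E3 | L ≤ ‖y‖ ∧ ‖y‖ ≤ M},
      ‖bern T.V T.P y * ⟪T.V y, y⟫ / ‖y‖ ^ 3‖ₑ ≤ C * ENNReal.ofReal (L / 2)⁻¹ := by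
    intro M
    have hSsub : {y : E3 | L ≤ ‖y‖ ∧ ‖y‖ ≤ M} ⊆ {y : E3 | L / 2 < ‖y‖} := fun y hy => by
      simp only [mem_setOf_eq] at hy ⊢
      linarith [hy.1]
    have hj : ∀ j : ℕ, ∫⁻ y in {y : E3 | L ≤ ‖y‖ ∧ ‖y‖ ≤ M},
        ‖bern T.V T.P y * ⟪T.V y, y⟫ / ‖y‖ ^ 3‖ₑ ≤
        C * ENNReal.ofReal (L / 2)⁻¹ + ∫⁻ y in {y : E3 | L ≤ ‖y‖ ∧ ‖y‖ ≤ M},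
          ‖bern (blowDown (T.R j) v) (blowDownP (T.R j) (fun x => p x - T.c)) y *
                ⟪blowDown (T.R j) v y, y⟫ / ‖y‖ ^ 3 -
            bern T.V T.P y * ⟪T.V y, y⟫ / ‖y‖ ^ 3‖ₑ := by
      intro j
      have hVj : Continuous (blowDown (T.R j) v) := continuous_blowDown hvc _
      have hPj : Continuous (blowDownP (T.R j) (fun x => p x - T.c)) := continuous_blowDownP hqc _
      have hbj : Continuous (bern (blowDown (T.R j) v) (blowDownP (T.R j) (fun x => p x - T.c))) := by
        unfold bern
        exact hPj.add ((hVj.norm.pow 2).div_const 2)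
      have hmj : AEMeasurable (fun y => ‖bern (blowDown (T.R j) v) (blowDownP (T.R j)
          (fun x => p x - T.c)) y * ⟪blowDown (T.R j) v y, y⟫ / ‖y‖ ^ 3‖ₑ)
          (volume.restrict {y : E3 | L ≤ ‖y‖ ∧ ‖y‖ ≤ M}) :=
        (((hbj.mul (hVj.inner continuous_id)).measurable.div
          (continuous_norm.pow 3).measurable).enorm).aemeasurable
      calc ∫⁻ y in {y : E3 | L ≤ ‖y‖ ∧ ‖y‖ ≤ M}, ‖bern T.V T.P y * ⟪T.V y, y⟫ / ‖y‖ ^ 3‖ₑ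
          ≤ ∫⁻ y in {y : E3 | L ≤ ‖y‖ ∧ ‖y‖ ≤ M},
              (‖bern (blowDown (T.R j) v) (blowDownP (T.R j) (fun x => p x - T.c)) y *
                  ⟪blowDown (T.R j) v y, y⟫ / ‖y‖ ^ 3‖ₑ +
              ‖bern (blowDown (T.R j) v) (blowDownP (T.R j) (fun x => p x - T.c)) y *
                    ⟪blowDown (T.R j) v y, y⟫ / ‖y‖ ^ 3 -
                bern T.V T.P y * ⟪T.V y, y⟫ / ‖y‖ ^ 3‖ₑ) :=
            lintegral_mono fun y => by
              calc ‖bern T.V T.P y * ⟪T.V y, y⟫ / ‖y‖ ^ 3‖ₑ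
                  = ‖bern (blowDown (T.R j) v) (blowDownP (T.R j) (fun x => p x - T.c)) y *
                      ⟪blowDown (T.R j) v y, y⟫ / ‖y‖ ^ 3 -
                    (bern (blowDown (T.R j) v) (blowDownP (T.R j) (fun x => p x - T.c)) y *
                        ⟪blowDown (T.R j) v y, y⟫ / ‖y‖ ^ 3 -
                      bern T.V T.P y * ⟪T.V y, y⟫ / ‖y‖ ^ 3)‖ₑ := by rw [sub_sub_cancel]
                _ ≤ _ := enorm_sub_le
        _ = (∫⁻ y in {y : E3 | L ≤ ‖y‖ ∧ ‖y‖ ≤ M},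
              ‖bern (blowDown (T.R j) v) (blowDownP (T.R j) (fun x => p x - T.c)) y *
                  ⟪blowDown (T.R j) v y, y⟫ / ‖y‖ ^ 3‖ₑ) +
            ∫⁻ y in {y : E3 | L ≤ ‖y‖ ∧ ‖y‖ ≤ M},
              ‖bern (blowDown (T.R j) v) (blowDownP (T.R j) (fun x => p x - T.c)) y *
                    ⟪blowDown (T.R j) v y, y⟫ / ‖y‖ ^ 3 -
                bern T.V T.P y * ⟪T.V y, y⟫ / ‖y‖ ^ 3‖ₑ := lintegral_add_left' hmj _
        _ ≤ C * ENNReal.ofReal (L / 2)⁻¹ + _ := by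
            gcongr ?_ + _
            calc ∫⁻ y in {y : E3 | L ≤ ‖y‖ ∧ ‖y‖ ≤ M},
                  ‖bern (blowDown (T.R j) v) (blowDownP (T.R j) (fun x => p x - T.c)) y *
                    ⟪blowDown (T.R j) v y, y⟫ / ‖y‖ ^ 3‖ₑ
                ≤ ∫⁻ y in {y : E3 | L / 2 < ‖y‖},
                    ‖bern (blowDown (T.R j) v) (blowDownP (T.R j) (fun x => p x - T.c)) y *
                      ⟪blowDown (T.R j) v y, y⟫ / ‖y‖ ^ 3‖ₑ := lintegral_mono_set hSsub
              _ ≤ ∫⁻ y in {y : E3 | L / 2 < ‖y‖}, ENNReal.ofReal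
                    (|bern (blowDown (T.R j) v) (blowDownP (T.R j) (fun x => p x - T.c)) y| *
                      ‖blowDown (T.R j) v y‖ * ‖y‖ ^ (-(2 : ℝ))) :=
                  lintegral_mono fun y => enorm_current_le _ _ y
              _ ≤ C * ENNReal.ofReal (L / 2)⁻¹ := hC (T.R j) (tangent_R_pos T j) (L / 2) (half_pos hL)
    have hlim : Tendsto (fun j : ℕ => C * ENNReal.ofReal (L / 2)⁻¹ +
        ∫⁻ y in {y : E3 | L ≤ ‖y‖ ∧ ‖y‖ ≤ M},
          ‖bern (blowDown (T.R j) v) (blowDownP (T.R j) (fun x => p x - T.c)) y *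
                ⟪blowDown (T.R j) v y, y⟫ / ‖y‖ ^ 3 -
            bern T.V T.P y * ⟪T.V y, y⟫ / ‖y‖ ^ 3‖ₑ) atTop (𝓝 (C * ENNReal.ofReal (L / 2)⁻¹)) := by
      have h := (tendsto_lintegral_current_sub_shell hflow T hL M).const_add
        (C * ENNReal.ofReal (L / 2)⁻¹)
      rwa [add_zero] at h
    exact ge_of_tendsto' hlim hj
  -- Step B: monotone exhaustion `{|y| > L} = ⋃_M {L < |y| ≤ M}`
  have hU : {y : E3 | L < ‖y‖} = ⋃ M : ℕ, {y : E3 | L < ‖y‖ ∧ ‖y‖ ≤ (M : ℝ)} := by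
    ext y
    simp only [mem_setOf_eq, mem_iUnion]
    constructor
    · intro h
      obtain ⟨M, hM⟩ := exists_nat_ge ‖y‖
      exact ⟨M, h, hM⟩
    · rintro ⟨M, h, -⟩
      exact h
  have hdir : Directed (· ⊆ ·) fun M : ℕ => {y : E3 | L < ‖y‖ ∧ ‖y‖ ≤ (M : ℝ)} := by
    refine Monotone.directed_le fun M N hMN y hy => ⟨hy.1, hy.2.trans ?_⟩
    exact_mod_cast hMN
  rw [hU, setLIntegral_iUnion_of_directed _ hdir]
  refine iSup_le fun M => le_trans (lintegral_mono_set ?_) (hA M)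
  intro y hy
  exact ⟨hy.1.le, hy.2⟩

/-! ## `Step_385` -/

/-- **`Step_385` PROVED — passage to the tangent current (3.83)–(3.85)** (p.25 l.127 – p.26 l.84): for
an `IsWuFlow` with `D > 0` and an Euler blow-down tangent `T`, the limit current `QV·y/|y|³` is
integrable on `{|y| > 1}` and `current382 (R_j) v (p − c) → −tangentCurrent T.V T.P`. Inputs of `T`
used: `weakP` (3.41), `locInt`, `convV` (3.28), `convP` (3.45), `hq0`; of the flow: smoothness only.
[cite: Wu2026, (3.83)–(3.85) p.25 l.127 – p.26 l.84] -/
theorem step_385 : Step_385 := by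
  intro ν hν v p hflow hDpos T
  have hvc : Continuous v := hflow.smooth_v.continuous
  have hvm : AEStronglyMeasurable v volume := hvc.aestronglyMeasurable
  have hqc : Continuous fun x => p x - T.c := hflow.smooth_p.continuous.sub continuous_const
  obtain ⟨C, hCt, hC⟩ := exists_rescaled_tail_le hvm T.weakP.1 T.weakP.2
  have hV : AEStronglyMeasurable T.V volume := T.locInt.1
  have hP : AEStronglyMeasurable T.P volume := T.locInt.2.1
  -- measurability of the current integrands
  have hcur_m : AEStronglyMeasurable (fun y => bern T.V T.P y * ⟪T.V y, y⟫ / ‖y‖ ^ 3)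
      (volume.restrict exterior) := by
    have hb : AEStronglyMeasurable (bern T.V T.P) volume := aestronglyMeasurable_bern hV hP
    exact ((hb.aemeasurable.mul (hV.aemeasurable.inner aemeasurable_id)).div
      (continuous_norm.pow 3).measurable.aemeasurable).aestronglyMeasurable.restrict
  have hcurj_m : ∀ j, AEStronglyMeasurable (fun y => bern (blowDown (T.R j) v)
      (blowDownP (T.R j) (fun x => p x - T.c)) y * ⟪blowDown (T.R j) v y, y⟫ / ‖y‖ ^ 3)
      (volume.restrict exterior) := by
    intro j
    have hVj : Continuous (blowDown (T.R j) v) := continuous_blowDown hvc _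
    have hPj : Continuous (blowDownP (T.R j) (fun x => p x - T.c)) := continuous_blowDownP hqc _
    have hbj : Continuous (bern (blowDown (T.R j) v) (blowDownP (T.R j) (fun x => p x - T.c))) := by
      unfold bern
      exact hPj.add ((hVj.norm.pow 2).div_const 2)
    exact (((hbj.mul (hVj.inner continuous_id)).measurable.div
      (continuous_norm.pow 3).measurable).aestronglyMeasurable).restrict
  -- the tails
  have htail_lim : ∀ L : ℝ, 0 < L → ∫⁻ y in {y : E3 | L < ‖y‖},
      ‖bern T.V T.P y * ⟪T.V y, y⟫ / ‖y‖ ^ 3‖ₑ ≤ C * ENNReal.ofReal (L / 2)⁻¹ :=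
    fun L hL => lintegral_tail_limit_le hflow T hC hL
  have htail_j : ∀ j : ℕ, ∀ L : ℝ, 0 < L → ∫⁻ y in {y : E3 | L < ‖y‖},
      ‖bern (blowDown (T.R j) v) (blowDownP (T.R j) (fun x => p x - T.c)) y *
        ⟪blowDown (T.R j) v y, y⟫ / ‖y‖ ^ 3‖ₑ ≤ C * ENNReal.ofReal L⁻¹ := fun j L hL =>
    (lintegral_mono fun y => enorm_current_le _ _ y).trans (hC (T.R j) (tangent_R_pos T j) L hL)
  -- (i) integrability of the limit current on `{|y| > 1}`
  have hint : IntegrableOn (fun y => bern T.V T.P y * ⟪T.V y, y⟫ / ‖y‖ ^ 3) exterior volume := by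
    refine ⟨hcur_m, ?_⟩
    have h1 := htail_lim 1 one_pos
    exact lt_of_le_of_lt h1 (ENNReal.mul_lt_top hCt.lt_top ENNReal.ofReal_lt_top)
  refine ⟨hint, ?_⟩
  -- (ii) the limit along the good scales
  have hcurrent : (fun j => current382 (T.R j) v (fun x => p x - T.c)) = fun j =>
      -∫ y in exterior, bern (blowDown (T.R j) v) (blowDownP (T.R j) (fun x => p x - T.c)) y *
        ⟪blowDown (T.R j) v y, y⟫ / ‖y‖ ^ 3 :=
    funext fun j => current382_eq_blowDown (tangent_R_pos T j) v _
  rw [hcurrent]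
  refine Tendsto.neg ?_
  show Tendsto (fun j => ∫ y in exterior, bern (blowDown (T.R j) v)
      (blowDownP (T.R j) (fun x => p x - T.c)) y * ⟪blowDown (T.R j) v y, y⟫ / ‖y‖ ^ 3) atTop
    (𝓝 (∫ y in exterior, bern T.V T.P y * ⟪T.V y, y⟫ / ‖y‖ ^ 3))
  refine tendsto_integral_of_L1 _ hcur_m (Eventually.of_forall fun j => ⟨hcurj_m j, ?_⟩) ?_
  · exact lt_of_le_of_lt (htail_j j 1 one_pos) (ENNReal.mul_lt_top hCt.lt_top ENNReal.ofReal_lt_top)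
  -- `L¹({|y| > 1})` convergence: «first letting j → ∞ and then L → ∞»
  rw [ENNReal.tendsto_nhds_zero]
  intro ε hε
  have hε2 : 0 < ε / 2 := ENNReal.half_pos hε.ne'
  -- choose the outer radius `L ≥ 1` with `C·(3/L) ≤ ε/2`
  have h3 : Tendsto (fun L : ℝ => C * ENNReal.ofReal (3 / L)) atTop (𝓝 0) := by
    have h1 : Tendsto (fun L : ℝ => (3 : ℝ) / L) atTop (𝓝 0) :=
      tendsto_const_nhds.div_atTop tendsto_id
    have h2 : Tendsto (fun L : ℝ => ENNReal.ofReal (3 / L)) atTop (𝓝 0) := by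
      rw [← ENNReal.ofReal_zero]
      exact ENNReal.tendsto_ofReal h1
    have := ENNReal.Tendsto.const_mul h2 (Or.inr hCt)
    rwa [mul_zero] at this
  obtain ⟨L, hLε, hL1⟩ : ∃ L : ℝ, C * ENNReal.ofReal (3 / L) ≤ ε / 2 ∧ 1 ≤ L :=
    ((h3.eventually (eventually_le_nhds hε2)).and (eventually_ge_atTop 1)).exists
  have hL : 0 < L := by linarith
  -- the shell term is eventually `≤ ε/2`
  have hloc := tendsto_lintegral_current_sub_shell hflow T one_pos L
  rw [ENNReal.tendsto_nhds_zero] at hloc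
  filter_upwards [hloc (ε / 2) hε2] with j hj
  have hsplit : exterior ⊆ {y : E3 | 1 ≤ ‖y‖ ∧ ‖y‖ ≤ L} ∪ {y : E3 | L < ‖y‖} := by
    intro y hy
    by_cases hyL : ‖y‖ ≤ L
    · exact Or.inl ⟨le_of_lt hy, hyL⟩
    · exact Or.inr (not_le.1 hyL)
  have hmj : AEMeasurable (fun y => ‖bern (blowDown (T.R j) v) (blowDownP (T.R j)
      (fun x => p x - T.c)) y * ⟪blowDown (T.R j) v y, y⟫ / ‖y‖ ^ 3‖ₑ)
      (volume.restrict {y : E3 | L < ‖y‖}) := by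
    have hVj : Continuous (blowDown (T.R j) v) := continuous_blowDown hvc _
    have hPj : Continuous (blowDownP (T.R j) (fun x => p x - T.c)) := continuous_blowDownP hqc _
    have hbj : Continuous (bern (blowDown (T.R j) v) (blowDownP (T.R j) (fun x => p x - T.c))) := by
      unfold bern
      exact hPj.add ((hVj.norm.pow 2).div_const 2)
    exact (((hbj.mul (hVj.inner continuous_id)).measurable.div
      (continuous_norm.pow 3).measurable).enorm).aemeasurable
  have hLsum : ENNReal.ofReal L⁻¹ + ENNReal.ofReal (L / 2)⁻¹ = ENNReal.ofReal (3 / L) := by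
    rw [← ENNReal.ofReal_add (by positivity) (by positivity)]
    congr 1
    field_simp
    ring
  calc ∫⁻ y in exterior, ‖bern (blowDown (T.R j) v) (blowDownP (T.R j) (fun x => p x - T.c)) y *
          ⟪blowDown (T.R j) v y, y⟫ / ‖y‖ ^ 3 - bern T.V T.P y * ⟪T.V y, y⟫ / ‖y‖ ^ 3‖ₑ
      ≤ ∫⁻ y in {y : E3 | 1 ≤ ‖y‖ ∧ ‖y‖ ≤ L} ∪ {y : E3 | L < ‖y‖},
          ‖bern (blowDown (T.R j) v) (blowDownP (T.R j) (fun x => p x - T.c)) y *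
            ⟪blowDown (T.R j) v y, y⟫ / ‖y‖ ^ 3 - bern T.V T.P y * ⟪T.V y, y⟫ / ‖y‖ ^ 3‖ₑ :=
        lintegral_mono_set hsplit
    _ ≤ (∫⁻ y in {y : E3 | 1 ≤ ‖y‖ ∧ ‖y‖ ≤ L},
          ‖bern (blowDown (T.R j) v) (blowDownP (T.R j) (fun x => p x - T.c)) y *
            ⟪blowDown (T.R j) v y, y⟫ / ‖y‖ ^ 3 - bern T.V T.P y * ⟪T.V y, y⟫ / ‖y‖ ^ 3‖ₑ) +
        ∫⁻ y in {y : E3 | L < ‖y‖},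
          ‖bern (blowDown (T.R j) v) (blowDownP (T.R j) (fun x => p x - T.c)) y *
            ⟪blowDown (T.R j) v y, y⟫ / ‖y‖ ^ 3 - bern T.V T.P y * ⟪T.V y, y⟫ / ‖y‖ ^ 3‖ₑ :=
        lintegral_union_le _ _ _
    _ ≤ ε / 2 + ((∫⁻ y in {y : E3 | L < ‖y‖},
          ‖bern (blowDown (T.R j) v) (blowDownP (T.R j) (fun x => p x - T.c)) y *
            ⟪blowDown (T.R j) v y, y⟫ / ‖y‖ ^ 3‖ₑ) +
        ∫⁻ y in {y : E3 | L < ‖y‖}, ‖bern T.V T.P y * ⟪T.V y, y⟫ / ‖y‖ ^ 3‖ₑ) := by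
        refine add_le_add hj ?_
        calc ∫⁻ y in {y : E3 | L < ‖y‖},
              ‖bern (blowDown (T.R j) v) (blowDownP (T.R j) (fun x => p x - T.c)) y *
                ⟪blowDown (T.R j) v y, y⟫ / ‖y‖ ^ 3 - bern T.V T.P y * ⟪T.V y, y⟫ / ‖y‖ ^ 3‖ₑ
            ≤ ∫⁻ y in {y : E3 | L < ‖y‖},
                (‖bern (blowDown (T.R j) v) (blowDownP (T.R j) (fun x => p x - T.c)) y *
                  ⟪blowDown (T.R j) v y, y⟫ / ‖y‖ ^ 3‖ₑ +
                ‖bern T.V T.P y * ⟪T.V y, y⟫ / ‖y‖ ^ 3‖ₑ) := lintegral_mono fun y => enorm_sub_le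
          _ = _ := lintegral_add_left' hmj _
    _ ≤ ε / 2 + (C * ENNReal.ofReal L⁻¹ + C * ENNReal.ofReal (L / 2)⁻¹) := by
        gcongr
        · exact htail_j j L hL
        · exact htail_lim L hL
    _ = ε / 2 + C * ENNReal.ofReal (3 / L) := by rw [← mul_add, hLsum]
    _ ≤ ε / 2 + ε / 2 := add_le_add le_rfl hLε
    _ = ε := ENNReal.add_halves ε

end Tangent

end Summit.NavierStokesRegularity.NavierStokesRegularity.Theorems.Wu2026Salvage

end

-- WHAT THIS IS NOT: not a claim about NS regularity or blow-up; not a claim about any author beyond the typed locator.
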